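import Summits.BirchSwinnertonDyer.BirchSwinnertonDyer.Theorems.UniversalToricDescentThinCombVisibility
import Summits.BirchSwinnertonDyer.Rank1Residual.X2.HidaLimitCongruenceAlgebra
import Literature.NumberTheory.EllipticCurves.DeShalit1987.KatzMeasureUnitTwistRing
import HarnessLib

/-!
# Tightness of the thin-comb rigidity lemma: `T₂` is INVISIBLE to rational comb divisibility, and each symmetry
# hypothesis of `dvd_pow_mul_of_weakReflection` is necessary
# (crux `RationalSplitIMCInclusionAtThree`, stmt-BirchSwinnertonDyer-24207, line `ratwall_thin_comb`; helper,
# `--supports stmt-BirchSwinnertonDyer-24207`; cell `pub/bsd-wall`, LEAD `cruxlead-24207` g3)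

WHY THIS FILE. The registered research stub `stub_ratCombDivisibilityUpTo` of line `ratwall_thin_comb` (skeleton v4,
`Cruxes/RationalSplitIMCInclusionAtThree/Lines/ratwall_thin_comb.lean`) is the conjunction K2-rat ⊕ K4 ⊕ K3(iii):
RATIONAL thin-comb divisibility `ThinCombDvdRat R₀ 3 G L₂` (K2 with per-tooth `3`-power slack) AND a weak reflection
`ρ` with `ρ G ∼ G` (K4, algebraic functional equation) and `ρ L₂ ∼ L₂` (K3(iii), analytic functional equation); the
composition `RationalSplitIMCInclusionAtThree_of` feeds the three into the rigidity lemma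
`…ThinComb.dvd_pow_mul_of_weakReflection` (Part VII) to get `G ∣ 3^a·L₂`. The LEAD census (g0 §3, g2 §2 «why the
weak reflection cannot be proved away») asserts that the two symmetry conjuncts cannot be dropped from this
composition. This file makes that assertion KERNEL-EXACT, for every DVR `𝒪` with maximal ideal `(p)` and for the
crux's own ring `R₀ = unrIntegers 3`:

* §1 `const_natCast_mem_span_T₂_combElt`: `p ∈ (T₂, E_m(T₂))` (the vertical element `E_m = Φ_{p^{m+1}}(1+T₂)` has
  constant term `p`), hence **`T₂`-INVISIBILITY** `ThinCombDvdRat.T₂_mul`: `ThinCombDvdRat 𝒪 p G F →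
  ThinCombDvdRat 𝒪 p (T₂·G) F` — multiplying `G` by (any power of) `T₂` costs one unit of slack per factor and is
  undetectable by the rational `T₂`-comb (this is the «invisible prime» phenomenon of LEAD-CENSUS-g2 §2 in its
  simplest instance);
* §2 `not_thinCombDvdRat_rigid`: rational comb divisibility ALONE is not rigid — `G = T₂`, `F = 1` satisfy
  `ThinCombDvdRat 𝒪 p T₂ 1` while `T₂ ∤ p^a` for every `a`;
* §3 for the constant-fixing swap `σ : T₁ ↔ T₂` (`IntSeries.transposeRingEquiv`, a WEAK REFLECTION:
  `σ T₂ = T₁ ∉ (p, T₂)`), the hypothesis `Associated (ρ G) G` (K4) of `dvd_pow_mul_of_weakReflection` cannot be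
  dropped (`G = T₂`, `F = 1`: `σ F = F`), and the hypothesis `Associated (ρ F) F` (K3(iii)) cannot be dropped
  (`G = T₁T₂ = σ G`, `F = T₁`): `not_rigid_without_G_symmetry`, `not_rigid_without_F_symmetry`;
* §4 the same three statements in the crux's ring `R₀⟦T₂⟧⟦T₁⟧ = Λ₂(unrIntegers 3)` at `p = 3`.

HONEST FRAMING. These are tightness statements about the LEMMA through which the line consumes its research stub;
they show that the SHAPE K2-rat ⊕ K4 ⊕ K3(iii) of `stub_ratCombDivisibilityUpTo` cannot be shortened to K2-rat, to
K2-rat ⊕ K3(iii) or to K2-rat ⊕ K4 inside this composition. They say nothing about whether the stub itself is true,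
nothing about Beilinson–Flach classes, and BSD is not proved for any curve by any of this.

References: [cite: Washington1997, Lemma 1.4, §7.1–§7.2 (`Φ_{p^{m+1}}(1) = p`; distinguished polynomials)];
[cite: deShalit1987, II.4.17 (54) (p. 78) (transposition of two-variable measures/series)].
-/

set_option linter.dupNamespace false
set_option autoImplicit false

noncomputable section

namespace Summit.BirchSwinnertonDyer.BirchSwinnertonDyer.Theorems.UniversalToricDescentThinComb.RatCombTightness

open Literature.NumberTheory.EllipticCurves
open Summit.BirchSwinnertonDyer.BirchSwinnertonDyer.Theorems.UniversalToricDescentThinComb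

/-! ## §1 `p ∈ (T₂, E_m(T₂))` and `T₂`-invisibility of rational comb divisibility -/

section Invisibility

variable (𝒪 : Type*) [CommRing 𝒪] (p : ℕ) [hp : Fact p.Prime]

/-- **`p ∈ (T₂, E_m(T₂))` in `Λ₂(𝒪)`**: the vertical element `E_m(T₂) = Φ_{p^{m+1}}(1 + T₂)` has constant term
`Φ_{p^{m+1}}(1) = p`, so `p = E_m(T₂) − T₂·q(T₂)`. [cite: Washington1997, Lemma 1.4 and §7.1] -/
theorem const_natCast_mem_span_T₂_combElt (m : ℕ) :
    const 𝒪 (p : 𝒪) ∈ Ideal.span {T₂ 𝒪, combElt 𝒪 p m} := by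
  have h0 : PowerSeries.constantCoeff (combSeries 𝒪 p m - PowerSeries.C (p : 𝒪)) = 0 := by
    rw [map_sub, constantCoeff_combSeries, PowerSeries.constantCoeff_C, sub_self]
  obtain ⟨q, hq⟩ := PowerSeries.X_dvd_iff.mpr h0
  have hC : PowerSeries.C (p : 𝒪) = combSeries 𝒪 p m - PowerSeries.X * q := by
    rw [← hq]; ring
  refine Ideal.mem_span_pair.mpr ⟨-PowerSeries.C q, 1, ?_⟩
  simp only [const, RingHom.comp_apply, T₂, combElt, hC, map_sub, map_mul]
  ring

omit hp in
/-- Comb divisibility is implied by honest divisibility (slack `t = 0` on every level).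
[cite: Washington1997, §7.1] -/
theorem thinCombDvdRat_of_dvd {G F : PowerSeries (PowerSeries 𝒪)} (h : G ∣ F) : ThinCombDvdRat 𝒪 p G F := by
  intro n
  obtain ⟨c, rfl⟩ := h
  refine ⟨n, le_rfl, 0, ?_⟩
  rw [pow_zero, map_one, one_mul]
  exact Ideal.mem_span_pair.mpr ⟨c, 0, by ring⟩

/-- **`T₂`-INVISIBILITY of rational comb divisibility**: if `G ∣ p^{t_m} F (mod E_m(T₂))` on levels of unbounded
order, then also `T₂·G ∣ p^{t_m + 1} F (mod E_m(T₂))` on the same levels — the factor `T₂` is absorbed by ONE extra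
unit of slack, because `p ∈ (T₂, E_m(T₂))`. So the rational `T₂`-comb cannot see whether `T₂ ∣ F`.
[cite: Washington1997, Lemma 1.4 and §7.1] -/
theorem ThinCombDvdRat.T₂_mul {G F : PowerSeries (PowerSeries 𝒪)} (h : ThinCombDvdRat 𝒪 p G F) :
    ThinCombDvdRat 𝒪 p (T₂ 𝒪 * G) F := by
  intro n
  obtain ⟨m, hnm, t, hmem⟩ := h n
  refine ⟨m, hnm, t + 1, ?_⟩
  obtain ⟨a, b, hab⟩ := Ideal.mem_span_pair.mp hmem
  obtain ⟨c, d, hcd⟩ := Ideal.mem_span_pair.mp (const_natCast_mem_span_T₂_combElt 𝒪 p m)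
  rw [pow_succ', map_mul, mul_assoc, ← hab, ← hcd]
  exact Ideal.mem_span_pair.mpr
    ⟨c * a, d * a * G + c * T₂ 𝒪 * b + d * combElt 𝒪 p m * b, by ring⟩

/-- `T₂^k`-invisibility: `ThinCombDvdRat 𝒪 p G F → ThinCombDvdRat 𝒪 p (T₂^k·G) F` (slack `+k`).
[cite: Washington1997, Lemma 1.4 and §7.1] -/
theorem ThinCombDvdRat.T₂_pow_mul {G F : PowerSeries (PowerSeries 𝒪)} (h : ThinCombDvdRat 𝒪 p G F) (k : ℕ) :
    ThinCombDvdRat 𝒪 p (T₂ 𝒪 ^ k * G) F := by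
  induction k with
  | zero => simpa only [pow_zero, one_mul] using h
  | succ k ih => simpa only [pow_succ', mul_assoc] using ThinCombDvdRat.T₂_mul 𝒪 p ih

/-- The basic invisible pair: `ThinCombDvdRat 𝒪 p T₂ 1` (indeed `p·1 ∈ (T₂, E_m(T₂))` on EVERY level).
[cite: Washington1997, Lemma 1.4 and §7.1] -/
theorem thinCombDvdRat_T₂_one : ThinCombDvdRat 𝒪 p (T₂ 𝒪) 1 := by
  simpa only [mul_one] using
    ThinCombDvdRat.T₂_mul 𝒪 p (thinCombDvdRat_of_dvd 𝒪 p (dvd_refl (1 : PowerSeries (PowerSeries 𝒪))))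

/-- The second invisible pair: `ThinCombDvdRat 𝒪 p (T₂·T₁) T₁`. [cite: Washington1997, Lemma 1.4 and §7.1] -/
theorem thinCombDvdRat_T₂_mul_T₁_T₁ : ThinCombDvdRat 𝒪 p (T₂ 𝒪 * T₁ 𝒪) (T₁ 𝒪) :=
  ThinCombDvdRat.T₂_mul 𝒪 p (thinCombDvdRat_of_dvd 𝒪 p (dvd_refl (T₁ 𝒪)))

omit hp in
/-- `T₂` divides no non-zero constant of `Λ₂(𝒪)` (read off the constant term). [cite: Washington1997, §7.1] -/
theorem T₂_not_dvd_const {c : 𝒪} (hc : c ≠ 0) : ¬ T₂ 𝒪 ∣ const 𝒪 c := by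
  rintro ⟨q, hq⟩
  have h := congrArg (fun F : PowerSeries (PowerSeries 𝒪) ↦ PowerSeries.constantCoeff (PowerSeries.constantCoeff F)) hq
  simp only [const, RingHom.comp_apply, T₂, PowerSeries.constantCoeff_C, map_mul, PowerSeries.constantCoeff_X,
    zero_mul] at h
  exact hc h

omit hp in
/-- `T₂·T₁` does not divide `c·T₁` for a non-zero constant `c` (read off the coefficient of `T₁`).
[cite: Washington1997, §7.1] -/
theorem T₂_mul_T₁_not_dvd_const_mul_T₁ {c : 𝒪} (hc : c ≠ 0) : ¬ T₂ 𝒪 * T₁ 𝒪 ∣ const 𝒪 c * T₁ 𝒪 := by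
  rintro ⟨q, hq⟩
  have h := congrArg (fun F : PowerSeries (PowerSeries 𝒪) ↦ PowerSeries.constantCoeff (PowerSeries.coeff 1 F)) hq
  have h1 : PowerSeries.coeff 1 (const 𝒪 c * T₁ 𝒪) = PowerSeries.C c := by
    simp only [const, RingHom.comp_apply, T₁, PowerSeries.coeff_C_mul, PowerSeries.coeff_one_X, mul_one]
  have h2 : PowerSeries.coeff 1 (T₂ 𝒪 * T₁ 𝒪 * q) = PowerSeries.X * PowerSeries.coeff 0 q := by
    rw [mul_assoc, T₂, PowerSeries.coeff_C_mul, T₁, show (1 : ℕ) = 0 + 1 from rfl, PowerSeries.coeff_succ_X_mul]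
  simp only [h1, h2, PowerSeries.constantCoeff_C, map_mul, PowerSeries.constantCoeff_X, zero_mul] at h
  exact hc h

end Invisibility

/-! ## §2 Rational comb divisibility alone is NOT rigid -/

section NotRigid

variable (𝒪 : Type*) [CommRing 𝒪] (p : ℕ) [hp : Fact p.Prime]

/-- **Rational comb divisibility alone is not rigid.** If no power of `p` vanishes in `𝒪` (e.g. `𝒪` a domain of
characteristic `0`, or any DVR with maximal ideal `(p)`), then it is FALSE that `ThinCombDvdRat 𝒪 p G F` implies
`G ∣ p^a F` for some `a`: the invisible pair `G = T₂`, `F = 1` is a counterexample. Hence some extra input — in the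
line `ratwall_thin_comb`, the weak reflection with BOTH symmetries (K4 and K3(iii)) — is needed to pass from the
comb to two-variable divisibility. [cite: Washington1997, §7.1–§7.2] -/
theorem not_thinCombDvdRat_rigid (hpa : ∀ a : ℕ, (p : 𝒪) ^ a ≠ 0) :
    ¬ ∀ G F : PowerSeries (PowerSeries 𝒪),
        ThinCombDvdRat 𝒪 p G F → ∃ a : ℕ, G ∣ const 𝒪 ((p : 𝒪) ^ a) * F := by
  intro h
  obtain ⟨a, ha⟩ := h _ _ (thinCombDvdRat_T₂_one 𝒪 p)
  rw [mul_one] at ha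
  exact T₂_not_dvd_const 𝒪 (hpa a) ha

end NotRigid

/-! ## §3 Each symmetry hypothesis of the weak-reflection rigidity lemma is necessary (witness: the swap) -/

section Swap

variable (𝒪 : Type*) [CommRing 𝒪] (p : ℕ) [hp : Fact p.Prime]

omit hp in
/-- The swap `σ : T₁ ↔ T₂` (`IntSeries.transposeRingEquiv`) fixes constants. [cite: deShalit1987, II.4.17 (54) (p. 78)] -/
theorem transpose_const (c : 𝒪) : IntSeries.transposeRingEquiv 𝒪 (const 𝒪 c) = const 𝒪 c := by
  rw [IntSeries.transposeRingEquiv_apply, const, RingHom.comp_apply, IntSeries.transpose_C, PowerSeries.map_C]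

omit hp in
/-- `σ T₂ = T₁`. [cite: deShalit1987, II.4.17 (54) (p. 78)] -/
theorem transpose_T₂ : IntSeries.transposeRingEquiv 𝒪 (T₂ 𝒪) = T₁ 𝒪 := by
  rw [IntSeries.transposeRingEquiv_apply, T₂, IntSeries.transpose_C, PowerSeries.map_X, T₁]

omit hp in
/-- `σ T₁ = T₂`. [cite: deShalit1987, II.4.17 (54) (p. 78)] -/
theorem transpose_T₁ : IntSeries.transposeRingEquiv 𝒪 (T₁ 𝒪) = T₂ 𝒪 := by
  rw [IntSeries.transposeRingEquiv_apply, T₁, IntSeries.transpose_X, T₂]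

omit hp in
/-- **The swap is a WEAK REFLECTION**: `σ T₂ = T₁ ∉ (p, T₂)` as soon as `p` is not a unit of `𝒪` (kill the inner
variable and read the coefficient of `T₁`). [cite: Washington1997, §13.4] -/
theorem transpose_T₂_not_mem (hpu : ¬ IsUnit (p : 𝒪)) :
    IntSeries.transposeRingEquiv 𝒪 (T₂ 𝒪) ∉ Ideal.span {const 𝒪 (p : 𝒪), T₂ 𝒪} := by
  rw [transpose_T₂]
  intro hmem
  obtain ⟨a, b, hab⟩ := Ideal.mem_span_pair.mp hmem
  -- kill the inner variable `T₂` and read off the coefficient of `T₁`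
  have h := congrArg
    (fun F : PowerSeries (PowerSeries 𝒪) ↦ PowerSeries.constantCoeff (PowerSeries.coeff 1 F)) hab
  simp only [const, RingHom.comp_apply, T₂, T₁, map_add, PowerSeries.coeff_mul_C, map_mul,
    PowerSeries.constantCoeff_C, PowerSeries.constantCoeff_X, mul_zero, add_zero, PowerSeries.coeff_one_X,
    map_one] at h
  exact hpu (IsUnit.of_mul_eq_one_right _ h)

/-- **K4 is necessary**: for the weak reflection `σ` (the swap), the hypothesis `Associated (ρ G) G` of
`dvd_pow_mul_of_weakReflection` cannot be dropped — `G = T₂`, `F = 1` has `σ F = F` and rational comb divisibility,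
but `T₂ ∤ p^a`. (Needs only: no power of `p` vanishes in `𝒪`.) [cite: Washington1997, §7.1–§7.2 and §13.4] -/
theorem not_rigid_without_G_symmetry (hpa : ∀ a : ℕ, (p : 𝒪) ^ a ≠ 0) :
    ¬ ∀ G F : PowerSeries (PowerSeries 𝒪),
        Associated (IntSeries.transposeRingEquiv 𝒪 F) F → ThinCombDvdRat 𝒪 p G F →
          ∃ a : ℕ, G ∣ const 𝒪 ((p : 𝒪) ^ a) * F := by
  intro h
  obtain ⟨a, ha⟩ := h (T₂ 𝒪) 1 (by rw [map_one]) (thinCombDvdRat_T₂_one 𝒪 p)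
  rw [mul_one] at ha
  exact T₂_not_dvd_const 𝒪 (hpa a) ha

/-- **K3(iii) is necessary**: for the weak reflection `σ` (the swap), the hypothesis `Associated (ρ F) F` of
`dvd_pow_mul_of_weakReflection` cannot be dropped — `G = T₂·T₁` is `σ`-symmetric (`σ G = T₁·T₂ = G`), `F = T₁`
satisfies rational comb divisibility w.r.t. `G`, but `T₂·T₁ ∤ p^a·T₁`. [cite: Washington1997, §7.1–§7.2 and §13.4] -/
theorem not_rigid_without_F_symmetry (hpa : ∀ a : ℕ, (p : 𝒪) ^ a ≠ 0) :
    ¬ ∀ G F : PowerSeries (PowerSeries 𝒪),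
        Associated (IntSeries.transposeRingEquiv 𝒪 G) G → ThinCombDvdRat 𝒪 p G F →
          ∃ a : ℕ, G ∣ const 𝒪 ((p : 𝒪) ^ a) * F := by
  intro h
  have hsym : Associated (IntSeries.transposeRingEquiv 𝒪 (T₂ 𝒪 * T₁ 𝒪)) (T₂ 𝒪 * T₁ 𝒪) := by
    rw [map_mul, transpose_T₂, transpose_T₁, mul_comm]
  obtain ⟨a, ha⟩ := h _ _ hsym (thinCombDvdRat_T₂_mul_T₁_T₁ 𝒪 p)
  exact T₂_mul_T₁_not_dvd_const_mul_T₁ 𝒪 (hpa a) ha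

end Swap

/-! ## §4 The crux's ring: `Λ₂(R₀)`, `R₀ = unrIntegers 3`, `p = 3` -/

section CruxRing

/-- In a DVR `𝒪` with maximal ideal `(p)` no power of `p` vanishes and `p` is not a unit (the standing hypotheses of
the rigidity lemma `dvd_pow_mul_of_weakReflection`). [cite: Washington1997, §7.1] -/
theorem pow_natCast_ne_zero_of_maximalIdeal_eq (𝒪 : Type*) [CommRing 𝒪] [IsDomain 𝒪] [IsDiscreteValuationRing 𝒪]
    (p : ℕ) (hmax : IsLocalRing.maximalIdeal 𝒪 = Ideal.span {(p : 𝒪)}) :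
    (∀ a : ℕ, (p : 𝒪) ^ a ≠ 0) ∧ ¬ IsUnit (p : 𝒪) := by
  have hirr : Irreducible (p : 𝒪) := (IsDiscreteValuationRing.irreducible_iff_uniformizer _).mpr hmax
  exact ⟨fun a ↦ pow_ne_zero a hirr.ne_zero, hirr.not_isUnit⟩

/-- `R₀ = unrIntegers 3`: no power of `3` vanishes and `3` is not a unit. [cite: Castella2018, §3 (p. 9)] -/
theorem pow_three_ne_zero_unrIntegers :
    (∀ a : ℕ, (((3 : ℕ) : ℕ) : unrIntegers 3) ^ a ≠ 0) ∧ ¬ IsUnit (((3 : ℕ) : ℕ) : unrIntegers 3) := by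
  haveI : Fact (Nat.Prime 3) := ⟨Nat.prime_three⟩
  have hirr := Summit.BirchSwinnertonDyer.Rank1Residual.X2.HidaLimitAlgebra.irreducible_natCast_p (p := 3)
  exact ⟨fun a ↦ pow_ne_zero a hirr.ne_zero, hirr.not_isUnit⟩

/-- **In the crux's ring, rational comb divisibility alone is not rigid**: there are `G, F ∈ R₀⟦T₂⟧⟦T₁⟧` with
`ThinCombDvdRat R₀ 3 G F` and `G ∤ 3^a F` for every `a` (`G = T₂`, `F = 1`). This is why line `ratwall_thin_comb`
keeps K4 ⊕ K3(iii) next to K2-rat in `stub_ratCombDivisibilityUpTo`. [cite: Washington1997, §7.1–§7.2] -/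
theorem not_thinCombDvdRat_rigid_unr :
    ¬ ∀ G F : PowerSeries (PowerSeries (unrIntegers 3)),
        ThinCombDvdRat (unrIntegers 3) 3 G F →
          ∃ a : ℕ, G ∣ const (unrIntegers 3) ((((3 : ℕ) : ℕ) : unrIntegers 3) ^ a) * F := by
  haveI : Fact (Nat.Prime 3) := ⟨Nat.prime_three⟩
  exact not_thinCombDvdRat_rigid (unrIntegers 3) 3 pow_three_ne_zero_unrIntegers.1

/-- **In the crux's ring, K4 cannot be dropped** from the rigidity step (witness: the swap `σ`, `G = T₂`, `F = 1`).
[cite: Washington1997, §7.1–§7.2 and §13.4] -/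
theorem not_rigid_without_G_symmetry_unr :
    ¬ ∀ G F : PowerSeries (PowerSeries (unrIntegers 3)),
        Associated (IntSeries.transposeRingEquiv (unrIntegers 3) F) F → ThinCombDvdRat (unrIntegers 3) 3 G F →
          ∃ a : ℕ, G ∣ const (unrIntegers 3) ((((3 : ℕ) : ℕ) : unrIntegers 3) ^ a) * F := by
  haveI : Fact (Nat.Prime 3) := ⟨Nat.prime_three⟩
  exact not_rigid_without_G_symmetry (unrIntegers 3) 3 pow_three_ne_zero_unrIntegers.1

/-- **In the crux's ring, K3(iii) cannot be dropped** from the rigidity step (witness: the swap `σ`, `G = T₂·T₁`,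
`F = T₁`). [cite: Washington1997, §7.1–§7.2 and §13.4] -/
theorem not_rigid_without_F_symmetry_unr :
    ¬ ∀ G F : PowerSeries (PowerSeries (unrIntegers 3)),
        Associated (IntSeries.transposeRingEquiv (unrIntegers 3) G) G → ThinCombDvdRat (unrIntegers 3) 3 G F →
          ∃ a : ℕ, G ∣ const (unrIntegers 3) ((((3 : ℕ) : ℕ) : unrIntegers 3) ^ a) * F := by
  haveI : Fact (Nat.Prime 3) := ⟨Nat.prime_three⟩
  exact not_rigid_without_F_symmetry (unrIntegers 3) 3 pow_three_ne_zero_unrIntegers.1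

/-- **The swap is a weak reflection of `Λ₂(R₀)` at `p = 3`**: it fixes constants and `σ T₂ ∉ (3, T₂)` — so the two
necessity statements above are about a `ρ` ADMISSIBLE in `stub_ratCombDivisibilityUpTo` / `dvd_pow_mul_of_weakReflection`.
[cite: Washington1997, §13.4] -/
theorem transpose_isWeakReflection_unr :
    (∀ c : unrIntegers 3, IntSeries.transposeRingEquiv (unrIntegers 3) (const (unrIntegers 3) c) =
        const (unrIntegers 3) c) ∧
      IntSeries.transposeRingEquiv (unrIntegers 3) (T₂ (unrIntegers 3)) ∉
        Ideal.span {const (unrIntegers 3) (((3 : ℕ) : ℕ) : unrIntegers 3), T₂ (unrIntegers 3)} :=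
  ⟨transpose_const (unrIntegers 3), transpose_T₂_not_mem (unrIntegers 3) 3 pow_three_ne_zero_unrIntegers.2⟩

end CruxRing

end Summit.BirchSwinnertonDyer.BirchSwinnertonDyer.Theorems.UniversalToricDescentThinComb.RatCombTightness

end
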